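/-
Copyright (c) 2026 the pub-hodgecm-mathlib formalisation cell (harness21).  Prover seat hodgecm-mathlib-F0P3a-p03 (g14), 2026-09-01.  Road «S3-tree» (census «S3» v3
0ca147ac, architect A-p16 (g28)), brick T6-1g (CENSUS-T6 4cc46265 §4 row (1)-inert, GENERAL `f`): the H-side STABLE germ expansion along an elliptic type-(1) torus of `H_v`
at an inert place, in the currency of S3-id's letter — the `+`-sign twin of ★ (β) HEAD `rankOneUnstable_core_inert` (p843756), folded through ★ T6-1u (p845211) and ★ T6-1u′ (p845235).
-/
import Literature.NumberTheory.Rogawski1990.RankOneStableDepthExpansion        -- ★ T6-1u p845211 (this seat): `sum_add_eq_depthExpansion_of_paritySums` (+ ★ (β) HEAD ED. 2 closure: pair theorems, S2∕S3∕S4, `exists_vertexCover`, asm §2, I-5c)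
import Literature.NumberTheory.Rogawski1990.RankOneStableOrbitalIntegralTorus    -- ★ T6-1u′ p845235 (this seat): `stableOrbitalIntegralRel_eq_integral_add_integral_of_frame` (+ ★ (G4) CMOfCore)
import HarnessLib

/-!
# The STABLE germ expansion of `Φ^st(·, f; m)` along an elliptic type-(1) torus of `H_v = U(Φ₂)(L⁺_v) × U(Φ₁)(L⁺_v)` at an inert place, for every `f ∈ C_c^∞(H_v)` and every
# CANONICAL family `m` (Rogawski 1990 §4.9 Lemma 4.9.3, §8.1 Prop. 8.1.1; Labesse–Langlands 1979 §2, §5)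

Topic `NumberTheory/Rogawski1990`; namespace `Literature.NumberTheory.Rogawski1990`.  THEOREMS ONLY (no definition, no instance, no notation, no named fact, no `sorry`); kernel lane
`--supports stmt-HodgeConjecture-24833`.  Cell `pub/hodgecm-mathlib` (D-0151), crux H413, line «N6nsGerm» last stub `stub_N6nsS3id`; road «S3-tree» (deal sheet = census «S3» v3
0ca147ac), brick **T6-1g** = the H-side GERM TABLE, row (1)-inert, for a GENERAL test function (CENSUS-T6 `F0/P3a/F0P3a-p03/g14/…` §3).  HONEST LABEL: HC_CM is proved only modulo the
printed citations (2 remaining named inputs hLiu418 24832, h413 24833) until rung 0 closes; this file is an ASSEMBLY over ★ material (no new arithmetic) and asserts nothing printed.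

THE MATHEMATICS [Rogawski1990 Prop. 8.1.1 (germ expansion on the endoscopic group); LabesseLanglands1979 §5].  Data as ★ (β) HEAD `rankOneUnstable_core_inert` MINUS the Hecke character:
a non-split `v` unramified in `L` (`w ∣ v`), a Haar measure `ν` on `H_v`, a family `m` CANONICAL for `(Reg, ν)` with `Reg` ⊆ `U(Φ₂)`-regular, conjugation- and stably closed (S3-id reads
`Reg := IsLocalGRegular L v`), `f ∈ C_c^∞(H_v)`, an elliptic type-(1) torus `Z(t₀)` framed by `(P, d)`.  CONCLUSION: there are a level `M`, and LOCALLY CONSTANT coefficient functions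
`Φm, Φ_0, …, Φ_{M−1} : Z(t₀) → ℂ` such that for every `t ∈ Z(t₀)` with `Reg ↑t` and depth `N(t) := ord_w(τ₀ t − τ₁ t) ≥ M`:
  **`Φ^st(↑t, f; m) = Φm(t) · W(N(t) − M) + Σ_{i<M} w_{N(t)−i} · Φ_i(t)`**, `W(n) = Σ_{j ≤ n} w_j` (`= ((q+1)q^n − 2)∕(q−1)`, ★ `cast_sub_one_mul_sum_weight_add_two`), `w_0 = 1`,
`w_j = q^{j−1}(q+1)` — i.e. the two-term STABLE germ `A(f,t) + B(f,t)·q^{N(t)}` (`q^{N} = |D_H(↑t)|^{−1∕2}` at an inert place) with `A, B` locally constant on the torus (constant near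
each singular point).  PROOF = ★ (β) HEAD's construction VERBATIM (stable partner ★ `exists_stablePartner_congr_uniformizer`; one-place model; `σ_w`; ★ `exists_vertexCover` and the PIECES
of `f` ★ I-5c `exists_sum_integral_conj_eq_of_vertexCover`; common level ★ S2; value points ★ LEMMA U; bits ★ S4; per-piece PAIRS ★ `depthExpansion_pair_selfDual∕_modular`), then:
`Φ^st(↑t, f; m) = O_ν(↑t, f) + O_ν(e ↑t, f)` (★ T6-1u′), `= Σ_k (O_ν(↑t, φ_k) + O_ν(e ↑t, φ_k))` (★ I-5c at `↑t` and `e ↑t`, ★ asm §2 properness ∕ trace), `=` the displayed sum (★ T6-1u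
`sum_add_eq_depthExpansion_of_paritySums`); local constancy of `Φm`, `Φ_i` by ★ S3 `isLocallyConstant_apply_symm_frameScalar_snd`, as in the HEAD.

* `stableOrbitalIntegralRel_depthExpansion_inert` — THE H-SIDE GERM TABLE, ROW (1)-INERT, GENERAL `f`.

## References
* [Rogawski1990] J. D. Rogawski, *Automorphic Representations of Unitary Groups in Three Variables*, Ann. of Math. Stud. 123 (1990): §4.9 Lemma 4.9.3 pp. 54–56; §8.1 Prop. 8.1.1
  p. 112; §3.5 Prop. 3.5.2 (c) p. 29; §3.6 pp. 31–32; §4.1 (4.1.1) p. 39.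
* [LabesseLanglands1979] J.-P. Labesse, R. P. Langlands, *L-indistinguishability for SL(2)*, Canad. J. Math. 31 (1979): §2, §5.
* [Kottwitz1988] R. E. Kottwitz, *Tamagawa numbers*, Ann. of Math. 127 (1988): §2.
-/

set_option autoImplicit false

noncomputable section

open Set Filter Topology MeasureTheory NumberField IsDedekindDomain Finset Matrix ValuativeRel Function MulAction
open scoped Matrix MatrixGroups ValuativeRel WithZero

namespace Literature.NumberTheory.Rogawski1990

open Literature.NumberTheory.Automorphic Literature.NumberTheory.Automorphic.UnitaryGroup Literature.NumberTheory.GaloisRepresentations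

section StableHead

variable (L : Type) [Field L] [NumberField L] [IsCMField L] (v : HeightOneSpectrum (𝓞 ↥(maximalRealSubfield L)))

-- `L_w`-sized statement and a long composition: elaboration budget only (no search)
set_option maxHeartbeats 1600000 in
/-- **THE H-SIDE GERM TABLE, ROW (1)-INERT, GENERAL `f` — the STABLE depth expansion of `Φ^st(·, f; m)` along an elliptic type-(1) torus.**  See the module docstring:
`∃ M Φm Φ, IsLocallyConstant Φm ∧ (∀ i < M, IsLocallyConstant (Φ i)) ∧ ∀ t ∈ Z(t₀), Reg ↑t → M ≤ N(t) →
 stableOrbitalIntegralRel (IsLocalStablyConjH L v) m f ↑t = Φm t · W(N(t) − M) + Σ_{i<M} w_{N(t)−i} · Φ i t`.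
[cite: Rogawski1990, §4.9 Lemma 4.9.3 pp. 54–56; §8.1 Prop. 8.1.1 p. 112; §4.1 (4.1.1) p. 39] [cite: LabesseLanglands1979, §2, §5] [cite: Kottwitz1988, §2] -/
theorem stableOrbitalIntegralRel_depthExpansion_inert (hv : Subsingleton (PlacesOver L v)) (hunr : Algebra.IsUnramifiedIn (𝓞 L) v.asIdeal)
    (w : PlacesOver L v) (hw : IsCMField.complexConj L • w.1 = w.1)
    [MeasurableSpace ((cmDatum L 2 (Matrix.of fun i j : Fin 2 => if i.val + j.val + 1 = 2 then (1 : L) else 0)).Local v × (cmDatum L 1 (Matrix.of fun i j : Fin 1 => if i.val + j.val + 1 = 1 then (1 : L) else 0)).Local v)] [BorelSpace ((cmDatum L 2 (Matrix.of fun i j : Fin 2 => if i.val + j.val + 1 = 2 then (1 : L) else 0)).Local v × (cmDatum L 1 (Matrix.of fun i j : Fin 1 => if i.val + j.val + 1 = 1 then (1 : L) else 0)).Local v)] (ν : Measure ((cmDatum L 2 (Matrix.of fun i j : Fin 2 => if i.val + j.val + 1 = 2 then (1 : L) else 0)).Local v × (cmDatum L 1 (Matrix.of fun i j : Fin 1 =>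 if i.val + j.val + 1 = 1 then (1 : L) else 0)).Local v)) [ν.IsHaarMeasure] [ν.IsMulRightInvariant]
    [iZ : ∀ γ : ((cmDatum L 2 (Matrix.of fun i j : Fin 2 => if i.val + j.val + 1 = 2 then (1 : L) else 0)).Local v × (cmDatum L 1 (Matrix.of fun i j : Fin 1 => if i.val + j.val + 1 = 1 then (1 : L) else 0)).Local v), MeasurableSpace (((cmDatum L 2 (Matrix.of fun i j : Fin 2 => if i.val + j.val + 1 = 2 then (1 : L) else 0)).Local v × (cmDatum L 1 (Matrix.of fun i j : Fin 1 => if i.val + j.val + 1 = 1 then (1 : L) else 0)).Local v) ⧸ Subgroup.centralizer ({γ} : Set ((cmDatum L 2 (Matrix.of fun i j : Fin 2 => if i.val + j.val + 1 = 2 then (1 : L) else 0)).Local v × (cmDatum L 1 (Matrix.of fun i j : Fin 1 => if i.val + j.val + 1 = 1 then (1 : L) else 0)).Local v)))]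
    [bZ : ∀ γ : ((cmDatum L 2 (Matrix.of fun i j : Fin 2 => if i.val + j.val + 1 = 2 then (1 : L) else 0)).Local v × (cmDatum L 1 (Matrix.of fun i j : Fin 1 => if i.val + j.val + 1 = 1 then (1 : L) else 0)).Local v), BorelSpace (((cmDatum L 2 (Matrix.of fun i j : Fin 2 => if i.val + j.val + 1 = 2 then (1 : L) else 0)).Local v × (cmDatum L 1 (Matrix.of fun i j : Fin 1 => if i.val + j.val + 1 = 1 then (1 : L) else 0)).Local v) ⧸ Subgroup.centralizer ({γ} : Set ((cmDatum L 2 (Matrix.of fun i j : Fin 2 => if i.val + j.val + 1 = 2 then (1 : L) else 0)).Local v × (cmDatum L 1 (Matrix.of fun i j : Fin 1 => if i.val + j.val + 1 = 1 then (1 : L) else 0)).Local v)))]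
    (m : OrbitalMeasureFamily ((cmDatum L 2 (Matrix.of fun i j : Fin 2 => if i.val + j.val + 1 = 2 then (1 : L) else 0)).Local v × (cmDatum L 1 (Matrix.of fun i j : Fin 1 => if i.val + j.val + 1 = 1 then (1 : L) else 0)).Local v))
    (Reg : ((cmDatum L 2 (Matrix.of fun i j : Fin 2 => if i.val + j.val + 1 = 2 then (1 : L) else 0)).Local v × (cmDatum L 1 (Matrix.of fun i j : Fin 1 => if i.val + j.val + 1 = 1 then (1 : L) else 0)).Local v) → Prop) (hReg : ∀ γ, Reg γ → IsRegularElt (γ.1.val : GL (Fin 2) (LocalRing L v))) (hconj : ∀ γ x, Reg γ → Reg (x * γ * x⁻¹))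
    (hstab : ∀ γ δ, Reg γ → IsLocalStablyConjH L v γ δ → Reg δ) (hm : m.IsCanonical Reg ν)
    (f : ((cmDatum L 2 (Matrix.of fun i j : Fin 2 => if i.val + j.val + 1 = 2 then (1 : L) else 0)).Local v × (cmDatum L 1 (Matrix.of fun i j : Fin 1 => if i.val + j.val + 1 = 1 then (1 : L) else 0)).Local v) → ℂ) (hf : IsLocSmooth f)
    (t₀ : ((cmDatum L 2 (Matrix.of fun i j : Fin 2 => if i.val + j.val + 1 = 2 then (1 : L) else 0)).Local v × (cmDatum L 1 (Matrix.of fun i j : Fin 1 => if i.val + j.val + 1 = 1 then (1 : L) else 0)).Local v)) (P : GL (Fin 2) (LocalRing L v)) (d : Fin 2 → (LocalRing L v)) (ht₀ : IsRegularElt (t₀.1.val : GL (Fin 2) (LocalRing L v)))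
    (hP : (t₀.1.val.val : Matrix (Fin 2) (Fin 2) (LocalRing L v)) * P.val = P.val * Matrix.diagonal d) (hd1 : ∀ i, conjLocal L (IsCMField.complexConj L) v (d i) * d i = 1) :
    ∃ (M : ℕ) (Φm : ↥(Subgroup.centralizer ({t₀} : Set ((cmDatum L 2 (Matrix.of fun i j : Fin 2 => if i.val + j.val + 1 = 2 then (1 : L) else 0)).Local v × (cmDatum L 1 (Matrix.of fun i j : Fin 1 => if i.val + j.val + 1 = 1 then (1 : L) else 0)).Local v))) → ℂ) (Φ : ℕ → ↥(Subgroup.centralizer ({t₀} : Set ((cmDatum L 2 (Matrix.of fun i j : Fin 2 => if i.val + j.val + 1 = 2 then (1 : L) else 0)).Local v × (cmDatum L 1 (Matrix.of fun i j : Fin 1 => if i.val + j.val + 1 = 1 then (1 : L) else 0)).Local v))) → ℂ), IsLocallyConstant Φm ∧ (∀ i ∈ Finset.range M, IsLocallyConstant (Φ i)) ∧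
      ∀ t : ↥(Subgroup.centralizer ({t₀} : Set ((cmDatum L 2 (Matrix.of fun i j : Fin 2 => if i.val + j.val + 1 = 2 then (1 : L) else 0)).Local v × (cmDatum L 1 (Matrix.of fun i j : Fin 1 => if i.val + j.val + 1 = 1 then (1 : L) else 0)).Local v))), Reg (t : ((cmDatum L 2 (Matrix.of fun i j : Fin 2 => if i.val + j.val + 1 = 2 then (1 : L) else 0)).Local v × (cmDatum L 1 (Matrix.of fun i j : Fin 1 => if i.val + j.val + 1 = 1 then (1 : L) else 0)).Local v)) → M ≤ (-WithZero.log (Valued.v ((((P⁻¹).val * ((t : ((cmDatum L 2 (Matrix.of fun i j : Fin 2 => if i.val + j.val + 1 = 2 then (1 : L) else 0)).Local v × (cmDatum L 1 (Matrix.of fun i j : Fin 1 => if i.val + j.val + 1 = 1 then (1 : L) else 0)).Local v)).1.val.val : Matrix (Fin 2) (Fin 2) (LocalRing L v)) * P.val) 0 0 - ((P⁻¹).val * ((t : ((cmDatum L 2 (Matrix.of fun i j : Fin 2 => if i.val + j.val + 1 = 2 then (1 : L) else 0)).Local v × (cmDatum L 1 (Matrix.of fun i j : Fin 1 => if i.val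 + j.val + 1 = 1 then (1 : L) else 0)).Local v)).1.val.val : Matrix (Fin 2) (Fin 2) (LocalRing L v)) * P.val) 1 1) w))).toNat →
        stableOrbitalIntegralRel (IsLocalStablyConjH L v) m f (t : ((cmDatum L 2 (Matrix.of fun i j : Fin 2 => if i.val + j.val + 1 = 2 then (1 : L) else 0)).Local v × (cmDatum L 1 (Matrix.of fun i j : Fin 1 => if i.val + j.val + 1 = 1 then (1 : L) else 0)).Local v)) =
          Φm t * (((∑ j ∈ Finset.range ((-WithZero.log (Valued.v ((((P⁻¹).val * ((t : ((cmDatum L 2 (Matrix.of fun i j : Fin 2 => if i.val + j.val + 1 = 2 then (1 : L) else 0)).Local v × (cmDatum L 1 (Matrix.of fun i j : Fin 1 => if i.val + j.val + 1 = 1 then (1 : L) else 0)).Local v)).1.val.val : Matrix (Fin 2) (Fin 2) (LocalRing L v)) * P.val) 0 0 - ((P⁻¹).val * ((t : ((cmDatum L 2 (Matrix.of fun i j : Fin 2 => if i.val + j.val + 1 = 2 then (1 : L) else 0)).Local v × (cmDatum L 1 (Matrix.of fun i j : Fin 1 => if i.val + j.val + 1 = 1 then (1 : L) else 0)).Local v)).1.val.val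 : Matrix (Fin 2) (Fin 2) (LocalRing L v)) * P.val) 1 1) w))).toNat - M + 1), (if j = 0 then 1 else (Nat.card (𝓞 ↥(maximalRealSubfield L) ⧸ v.asIdeal)) ^ (j - 1) * ((Nat.card (𝓞 ↥(maximalRealSubfield L) ⧸ v.asIdeal)) + 1))) : ℕ) : ℂ) +
            ∑ i ∈ Finset.range M, (((if (-WithZero.log (Valued.v ((((P⁻¹).val * ((t : ((cmDatum L 2 (Matrix.of fun i j : Fin 2 => if i.val + j.val + 1 = 2 then (1 : L) else 0)).Local v × (cmDatum L 1 (Matrix.of fun i j : Fin 1 => if i.val + j.val + 1 = 1 then (1 : L) else 0)).Local v)).1.val.val : Matrix (Fin 2) (Fin 2) (LocalRing L v)) * P.val) 0 0 - ((P⁻¹).val * ((t : ((cmDatum L 2 (Matrix.of fun i j : Fin 2 => if i.val + j.val + 1 = 2 then (1 : L) else 0)).Local v × (cmDatum L 1 (Matrix.of fun i j : Fin 1 => if i.val + j.val + 1 = 1 then (1 : L) else 0)).Local v)).1.val.val : Matrix (Fin 2) (Fin 2) (LocalRing L v)) * P.val) 1 1) w))).toNat - i = 0 then 1 else (Nat.card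 (𝓞 ↥(maximalRealSubfield L) ⧸ v.asIdeal)) ^ ((-WithZero.log (Valued.v ((((P⁻¹).val * ((t : ((cmDatum L 2 (Matrix.of fun i j : Fin 2 => if i.val + j.val + 1 = 2 then (1 : L) else 0)).Local v × (cmDatum L 1 (Matrix.of fun i j : Fin 1 => if i.val + j.val + 1 = 1 then (1 : L) else 0)).Local v)).1.val.val : Matrix (Fin 2) (Fin 2) (LocalRing L v)) * P.val) 0 0 - ((P⁻¹).val * ((t : ((cmDatum L 2 (Matrix.of fun i j : Fin 2 => if i.val + j.val + 1 = 2 then (1 : L) else 0)).Local v × (cmDatum L 1 (Matrix.of fun i j : Fin 1 => if i.val + j.val + 1 = 1 then (1 : L) else 0)).Local v)).1.val.val : Matrix (Fin 2) (Fin 2) (LocalRing L v)) * P.val) 1 1) w))).toNat - i - 1) * ((Nat.card (𝓞 ↥(maximalRealSubfield L) ⧸ v.asIdeal)) + 1) : ℕ)) : ℂ) * Φ i t := by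
  classical
  -- scalars at `w`
  have hϖ0 := toPlace_uniformizer_ne_zero L v w hunr
  have hϖv := Liu2021.LemD1IndexedNonVacuityInertCofinite.valued_toPlace_uniformizer_of_isUnramifiedIn L v hunr w
  have hϖ : IsUniformizingElement (toPlace v w (HeckeCharacter.uniformizer ↥(maximalRealSubfield L) v : v.adicCompletion ↥(maximalRealSubfield L))) := isUniformizingElement_of_v_eq hϖv
  have hσϖ := galAdicCompletionMap_toPlace_self L v w hw (HeckeCharacter.uniformizer ↥(maximalRealSubfield L) v : v.adicCompletion ↥(maximalRealSubfield L))
  have hσϖu : (galAdicCompletionMap (L := L) (IsCMField.complexConj L) hw) ((Units.mk0 (toPlace v w (HeckeCharacter.uniformizer ↥(maximalRealSubfield L) v : v.adicCompletion ↥(maximalRealSubfield L))) hϖ0 : ((w.1.adicCompletion L))ˣ) : (w.1.adicCompletion L)) = (Units.mk0 (toPlace v w (HeckeCharacter.uniformizer ↥(maximalRealSubfield L) v : v.adicCompletion ↥(maximalRealSubfield L))) hϖ0 : ((w.1.adicCompletion L))ˣ) := by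
    rw [Units.val_mk0]; exact hσϖ
  have hJ := placeForm_antidiagTwo_eq_swap_lit L v w
  -- the stable partner `e = (Ad T_r, id)` and the density of the regular locus
  obtain ⟨hr₀, e, he2, -, heframe, hest⟩ := exists_stablePartner_congr_uniformizer L v hv hunr t₀ P d ht₀ hP hd1
  -- the one-place model, re-typed on the `cmDatum` carrier
  obtain ⟨E₂, hE₂⟩ : ∃ E₂ : (cmDatum L 2 (Matrix.of fun i j : Fin 2 => if i.val + j.val + 1 = 2 then (1 : L) else 0)).Local v ≃ₜ* ↥(unitaryGroupOfForm (galAdicCompletionMap (L := L) (IsCMField.complexConj L) hw) (placeForm (Matrix.of fun i j : Fin 2 => if i.val + j.val + 1 = 2 then (1 : L) else 0) w.1)), ∀ g, ((E₂ g : ↥(unitaryGroupOfForm (galAdicCompletionMap (L := L) (IsCMField.complexConj L) hw) (placeForm (Matrix.of fun i j : Fin 2 => if i.val + j.val + 1 = 2 then (1 : L) else 0) w.1))) : GL (Fin 2) (w.1.adicCompletion L)) =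
      ((localNonsplitEquiv (IsCMField.complexConj L) (Matrix.of fun i j : Fin 2 => if i.val + j.val + 1 = 2 then (1 : L) else 0) (IsCMField.complexConj_ne_one L) w hw g : ↥(unitaryGroupOfForm (galAdicCompletionMap (L := L) (IsCMField.complexConj L) hw) (placeForm (Matrix.of fun i j : Fin 2 => if i.val + j.val + 1 = 2 then (1 : L) else 0) w.1))) : GL (Fin 2) (w.1.adicCompletion L)) :=
    ⟨localNonsplitEquiv (IsCMField.complexConj L) (Matrix.of fun i j : Fin 2 => if i.val + j.val + 1 = 2 then (1 : L) else 0) (IsCMField.complexConj_ne_one L) w hw, fun _ => rfl⟩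
  -- `σ_w` on `𝒪_w` and `δ = σ a₀ − a₀`
  obtain ⟨σO, a₀, hσO', hσσ, ha₀, -⟩ := exists_integer_involution_of_isUnramifiedIn L v w hw hunr
  have hσδ := galAdicCompletionMap_delta_eq_neg L v w hw σO hσO' hσσ a₀
  have hδO : ((σO a₀ - a₀ : 𝒪[(w.1.adicCompletion L)]) : (w.1.adicCompletion L)) ∈ 𝒪[(w.1.adicCompletion L)] := (σO a₀ - a₀).2
  -- the vertex cover and the pieces of `f`
  obtain ⟨K₂, -, hd0, hd1', hK₂o, hK₂c, hcov⟩ := exists_vertexCover L v w hw hunr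
  obtain ⟨n, ε, φk, hφk, hφkK, hφkinv, hint⟩ := exists_sum_integral_conj_eq_of_vertexCover L v w hw ν K₂ hK₂o hK₂c hcov hf
  have hdict0 : ∀ g, g ∈ K₂ 0 ↔ E₂ g ∈ ((glInt 2 (w.1.adicCompletion L)).subgroupOf (unitaryGroupOfForm (galAdicCompletionMap (L := L) (IsCMField.complexConj L) hw) (placeForm (Matrix.of fun i j : Fin 2 => if i.val + j.val + 1 = 2 then (1 : L) else 0) w.1))) := fun g => by
    rw [Subgroup.mem_subgroupOf, hE₂]; exact hd0 g
  have hdict1 : ∀ g, g ∈ K₂ 1 ↔ E₂ g ∈ (((glInt 2 (w.1.adicCompletion L)).map (MulAut.conj (glDiagonal 2 (w.1.adicCompletion L) ![1, Units.mk0 (toPlace v w (HeckeCharacter.uniformizer ↥(maximalRealSubfield L) v : v.adicCompletion ↥(maximalRealSubfield L))) (toPlace_uniformizer_ne_zero L v w hunr)])).toMonoidHom).subgroupOf (unitaryGroupOfForm (galAdicCompletionMap (L := L) (IsCMField.complexConj L) hw) (placeForm (Matrix.of fun i j : Fin 2 => if i.val + j.val + 1 = 2 then (1 : L) else 0) w.1)))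 := fun g => by
    rw [Subgroup.mem_subgroupOf, hE₂]; exact hd1' g
  have hε : ∀ k, ε k = 0 ∨ ε k = 1 := by
    intro k
    generalize ε k = x
    fin_cases x <;> simp
  -- ★ S2: the common level `m₀` and the right-invariance of every piece at the one place
  obtain ⟨m₀, -, hKm₀, hφm₀⟩ := exists_level_data_onePlace L v w hw hunr E₂ φk (fun k => (hφk k).1) (fun k => (hφk k).2)
  have hS3 : ∀ (k : Fin n) (x : ((cmDatum L 2 (Matrix.of fun i j : Fin 2 => if i.val + j.val + 1 = 2 then (1 : L) else 0)).Local v × (cmDatum L 1 (Matrix.of fun i j : Fin 1 => if i.val + j.val + 1 = 1 then (1 : L) else 0)).Local v)) (y : ↥(unitaryGroupOfForm (galAdicCompletionMap (L := L) (IsCMField.complexConj L) hw) (placeForm (Matrix.of fun i j : Fin 2 => if i.val + j.val + 1 = 2 then (1 : L) else 0) w.1))), (∀ r s, (toPlace v w (HeckeCharacter.uniformizer ↥(maximalRealSubfield L) v : v.adicCompletion ↥(maximalRealSubfield L))) ^ (-(m₀ : ℤ)) * ((((y : ↥(unitaryGroupOfForm (galAdicCompletionMap (L := L) (IsCMField.complexConj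 L) hw) (placeForm (Matrix.of fun i j : Fin 2 => if i.val + j.val + 1 = 2 then (1 : L) else 0) w.1))) : GL (Fin 2) (w.1.adicCompletion L)) : Matrix (Fin 2) (Fin 2) (w.1.adicCompletion L)) - 1) r s ∈ 𝒪[(w.1.adicCompletion L)]) → φk k (x * (E₂.symm y, 1)) = φk k x := by
    intro k x y hy
    have h := hφm₀ k x.2 (E₂ x.1) y (hKm₀ y hy)
    rw [map_mul, ContinuousMulEquiv.symm_apply_apply] at h
    have hx : x * (E₂.symm y, 1) = (x.1 * E₂.symm y, x.2) := Prod.ext rfl (mul_one _)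
    rw [hx]
    exact h
  -- value points along the torus: `xm t = τ₁(t)_w • 1`, `xs t i = τ₁(t)_w (1 + ϖ_w^i N_δ)` (★ LEMMA U normal forms)
  have hcw : ∀ t : ↥(Subgroup.centralizer ({t₀} : Set ((cmDatum L 2 (Matrix.of fun i j : Fin 2 => if i.val + j.val + 1 = 2 then (1 : L) else 0)).Local v × (cmDatum L 1 (Matrix.of fun i j : Fin 1 => if i.val + j.val + 1 = 1 then (1 : L) else 0)).Local v))), (galAdicCompletionMap (L := L) (IsCMField.complexConj L) hw) ((((P⁻¹).val * ((t : ((cmDatum L 2 (Matrix.of fun i j : Fin 2 => if i.val + j.val + 1 = 2 then (1 : L) else 0)).Local v × (cmDatum L 1 (Matrix.of fun i j : Fin 1 => if i.val + j.val + 1 = 1 then (1 : L) else 0)).Local v)).1.val.val : Matrix (Fin 2) (Fin 2) (LocalRing L v)) * P.val) 1 1) w) * ((((P⁻¹).val * ((t : ((cmDatum L 2 (Matrix.of fun i j : Fin 2 => if i.val + j.val + 1 = 2 then (1 : L) else 0)).Local v × (cmDatum L 1 (Matrix.of fun i j : Fin 1 => if i.val + j.val + 1 = 1 then (1 : L) else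 0)).Local v)).1.val.val : Matrix (Fin 2) (Fin 2) (LocalRing L v)) * P.val) 1 1) w) = 1 := fun t => by
    have h := congrArg (fun x : LocalRing L v => x w) (conjLocal_frameEntry_mul_self_apply L v w hw t₀ P d ht₀ hP hd1 t 1)
    simpa only [Pi.mul_apply, Pi.one_apply, conjLocal_apply_eq_galAdicCompletionMap L v w hw] using h
  have hex : ∀ t : ↥(Subgroup.centralizer ({t₀} : Set ((cmDatum L 2 (Matrix.of fun i j : Fin 2 => if i.val + j.val + 1 = 2 then (1 : L) else 0)).Local v × (cmDatum L 1 (Matrix.of fun i j : Fin 1 => if i.val + j.val + 1 = 1 then (1 : L) else 0)).Local v))), ∃ (xm : ↥(unitaryGroupOfForm (galAdicCompletionMap (L := L) (IsCMField.complexConj L) hw) (placeForm (Matrix.of fun i j : Fin 2 => if i.val + j.val + 1 = 2 then (1 : L) else 0) w.1))) (xs : ℕ → ↥(unitaryGroupOfForm (galAdicCompletionMap (L := L) (IsCMField.complexConj L) hw) (placeForm (Matrix.of fun i j : Fin 2 => if i.val + j.val + 1 = 2 then (1 : L) else 0) w.1))), (((xm : ↥(unitaryGroupOfForm (galAdicCompletionMap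 (L := L) (IsCMField.complexConj L) hw) (placeForm (Matrix.of fun i j : Fin 2 => if i.val + j.val + 1 = 2 then (1 : L) else 0) w.1))) : GL (Fin 2) (w.1.adicCompletion L)) : Matrix (Fin 2) (Fin 2) (w.1.adicCompletion L)) = ((((P⁻¹).val * ((t : ((cmDatum L 2 (Matrix.of fun i j : Fin 2 => if i.val + j.val + 1 = 2 then (1 : L) else 0)).Local v × (cmDatum L 1 (Matrix.of fun i j : Fin 1 => if i.val + j.val + 1 = 1 then (1 : L) else 0)).Local v)).1.val.val : Matrix (Fin 2) (Fin 2) (LocalRing L v)) * P.val) 1 1) w) • (1 : Matrix (Fin 2) (Fin 2) (w.1.adicCompletion L)) ∧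
      ∀ i, (((xs i : ↥(unitaryGroupOfForm (galAdicCompletionMap (L := L) (IsCMField.complexConj L) hw) (placeForm (Matrix.of fun i j : Fin 2 => if i.val + j.val + 1 = 2 then (1 : L) else 0) w.1))) : GL (Fin 2) (w.1.adicCompletion L)) : Matrix (Fin 2) (Fin 2) (w.1.adicCompletion L)) = ((((P⁻¹).val * ((t : ((cmDatum L 2 (Matrix.of fun i j : Fin 2 => if i.val + j.val + 1 = 2 then (1 : L) else 0)).Local v × (cmDatum L 1 (Matrix.of fun i j : Fin 1 => if i.val + j.val + 1 = 1 then (1 : L) else 0)).Local v)).1.val.val : Matrix (Fin 2) (Fin 2) (LocalRing L v)) * P.val) 1 1) w) • ((1 : Matrix (Fin 2) (Fin 2) (w.1.adicCompletion L)) + (toPlace v w (HeckeCharacter.uniformizer ↥(maximalRealSubfield L) v : v.adicCompletion ↥(maximalRealSubfield L))) ^ i • !![0, ((σO a₀ - a₀ : 𝒪[(w.1.adicCompletion L)]) : (w.1.adicCompletion L)); 0, 0]) := fun t => by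
    obtain ⟨xm, x, -, -, hxm, -, hx, -⟩ := exists_unitary_normalForm_elements (galAdicCompletionMap (L := L) (IsCMField.complexConj L) hw) (placeForm (Matrix.of fun i j : Fin 2 => if i.val + j.val + 1 = 2 then (1 : L) else 0) w.1) hJ (hcw t)
      (valuation_eq_one_of_galAdicCompletionMap_mul_self L v w hw (hcw t)) hσϖ hϖ.mem hσδ hδO
    exact ⟨xm, x, hxm, hx⟩
  choose xm xs hxm hxs using hex
  -- `e_ϖ⁻¹ = Ad(D_ϖ)`: the window value points of the `ϖ`-modular type
  obtain ⟨eϖ, -, heϖs, -⟩ := exists_continuousMulEquiv_modular L w hw (Units.mk0 (toPlace v w (HeckeCharacter.uniformizer ↥(maximalRealSubfield L) v : v.adicCompletion ↥(maximalRealSubfield L))) hϖ0) hσϖu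
  obtain ⟨hD1, hD2⟩ := coe_glDiagonal_one_eq (Units.mk0 (toPlace v w (HeckeCharacter.uniformizer ↥(maximalRealSubfield L) v : v.adicCompletion ↥(maximalRealSubfield L))) hϖ0)
  have hxs' : ∀ (t : ↥(Subgroup.centralizer ({t₀} : Set ((cmDatum L 2 (Matrix.of fun i j : Fin 2 => if i.val + j.val + 1 = 2 then (1 : L) else 0)).Local v × (cmDatum L 1 (Matrix.of fun i j : Fin 1 => if i.val + j.val + 1 = 1 then (1 : L) else 0)).Local v)))) (i : ℕ), (((eϖ.symm (xs t i) : ↥(unitaryGroupOfForm (galAdicCompletionMap (L := L) (IsCMField.complexConj L) hw) (placeForm (Matrix.of fun i j : Fin 2 => if i.val + j.val + 1 = 2 then (1 : L) else 0) w.1))) : GL (Fin 2) (w.1.adicCompletion L)) : Matrix (Fin 2) (Fin 2) (w.1.adicCompletion L)) = ((((P⁻¹).val * ((t : ((cmDatum L 2 (Matrix.of fun i j : Fin 2 => if i.val + j.val + 1 = 2 then (1 : L) else 0)).Local v × (cmDatum L 1 (Matrix.of fun i j : Fin 1 => if i.val + j.val + 1 = 1 then (1 : L) else 0)).Local v)).1.val.val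 : Matrix (Fin 2) (Fin 2) (LocalRing L v)) * P.val) 1 1) w) • ((1 : Matrix (Fin 2) (Fin 2) (w.1.adicCompletion L)) + ((toPlace v w (HeckeCharacter.uniformizer ↥(maximalRealSubfield L) v : v.adicCompletion ↥(maximalRealSubfield L))) ^ i * ((toPlace v w (HeckeCharacter.uniformizer ↥(maximalRealSubfield L) v : v.adicCompletion ↥(maximalRealSubfield L))))⁻¹) • !![0, ((σO a₀ - a₀ : 𝒪[(w.1.adicCompletion L)]) : (w.1.adicCompletion L)); 0, 0]) := fun t i => by
    rw [heϖs, Units.val_mul, Units.val_mul, hxs t i, hD1, hD2, Units.val_inv_eq_inv_val, Units.val_mk0]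
    exact diagonal_mul_smul_one_add_mul_diagonal_inv _ hϖ0 _ _ _
  -- the bits: `e₀` for the self-dual type at `↑t`; type `1` reads `1 - e₀`; the partner always reads `1 -` the bit of `↑t`
  obtain ⟨e₀, he₀⟩ : ∃ e₀ : ℕ, e₀ = if Even (WithZero.log (Valued.v (twistGram (galAdicCompletionMap (L := L) (IsCMField.complexConj L) hw) (placeForm (Matrix.of fun i j : Fin 2 => if i.val + j.val + 1 = 2 then (1 : L) else 0) w.1) (((((Matrix.GeneralLinearGroup.map (Pi.evalRingHom (fun w' : PlacesOver L v => w'.1.adicCompletion L) w) P)) : GL (Fin 2) (w.1.adicCompletion L)) : Matrix (Fin 2) (Fin 2) (w.1.adicCompletion L))) 0 0))) then 0 else 1 := ⟨_, rfl⟩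
  have he₀1 : e₀ ≤ 1 := by rw [he₀]; split_ifs <;> omega
  have he₀par : Even (WithZero.log (Valued.v (twistGram (galAdicCompletionMap (L := L) (IsCMField.complexConj L) hw) (placeForm (Matrix.of fun i j : Fin 2 => if i.val + j.val + 1 = 2 then (1 : L) else 0) w.1) (((((Matrix.GeneralLinearGroup.map (Pi.evalRingHom (fun w' : PlacesOver L v => w'.1.adicCompletion L) w) P)) : GL (Fin 2) (w.1.adicCompletion L)) : Matrix (Fin 2) (Fin 2) (w.1.adicCompletion L))) 0 0))) ↔ e₀ = 0 := by
    rw [he₀]; split_ifs with h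
    · exact ⟨fun _ => rfl, fun _ => h⟩
    · exact ⟨fun h' => absurd h' h, fun h' => absurd h' (by decide)⟩
  have he₁par : Even (WithZero.log (Valued.v (twistGram (galAdicCompletionMap (L := L) (IsCMField.complexConj L) hw) (placeForm (Matrix.of fun i j : Fin 2 => if i.val + j.val + 1 = 2 then (1 : L) else 0) w.1) (((((Matrix.GeneralLinearGroup.map (Pi.evalRingHom (fun w' : PlacesOver L v => w'.1.adicCompletion L) w) P)) : GL (Fin 2) (w.1.adicCompletion L)) : Matrix (Fin 2) (Fin 2) (w.1.adicCompletion L))) 0 0))) ↔ 1 - e₀ = 1 := by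
    rw [he₀]; split_ifs with h
    · exact ⟨fun _ => rfl, fun _ => h⟩
    · exact ⟨fun h' => absurd h' h, fun h' => absurd h' (by decide)⟩
  -- per-piece bookkeeping as functions of `k`
  obtain ⟨b, hb⟩ : ∃ b : Fin n → ℕ, ∀ k, b k = if ε k = 0 then e₀ else 1 - e₀ := ⟨_, fun _ => rfl⟩
  have hb1 : ∀ k, b k ≤ 1 := fun k => by rw [hb]; split_ifs <;> omega
  obtain ⟨r, hr⟩ : ∃ r : Fin n → ℝ, ∀ k, r k = ν.real (((K₂ (ε k)).prod (⊤ : Subgroup ((cmDatum L 1 (Matrix.of fun i j : Fin 1 => if i.val + j.val + 1 = 1 then (1 : L) else 0)).Local v)) : Subgroup ((cmDatum L 2 (Matrix.of fun i j : Fin 2 => if i.val + j.val + 1 = 2 then (1 : L) else 0)).Local v × (cmDatum L 1 (Matrix.of fun i j : Fin 1 => if i.val + j.val + 1 = 1 then (1 : L) else 0)).Local v)) : Set ((cmDatum L 2 (Matrix.of fun i j : Fin 2 => if i.val + j.val + 1 = 2 then (1 : L) else 0)).Local v × (cmDatum L 1 (Matrix.of fun i j : Fin 1 => if i.val + j.val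 + 1 = 1 then (1 : L) else 0)).Local v)) := ⟨_, fun _ => rfl⟩
  obtain ⟨XS, hXS⟩ : ∃ XS : Fin n → ℕ → ↥(Subgroup.centralizer ({t₀} : Set ((cmDatum L 2 (Matrix.of fun i j : Fin 2 => if i.val + j.val + 1 = 2 then (1 : L) else 0)).Local v × (cmDatum L 1 (Matrix.of fun i j : Fin 1 => if i.val + j.val + 1 = 1 then (1 : L) else 0)).Local v))) → ↥(unitaryGroupOfForm (galAdicCompletionMap (L := L) (IsCMField.complexConj L) hw) (placeForm (Matrix.of fun i j : Fin 2 => if i.val + j.val + 1 = 2 then (1 : L) else 0) w.1)), ∀ k i t, XS k i t = if ε k = 0 then xs t i else eϖ.symm (xs t i) := ⟨_, fun _ _ _ => rfl⟩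
  -- §3: the pair of expansions of every piece, at `↑t` and at `e ↑t`
  have hpair : ∀ (k : Fin n) (t : ↥(Subgroup.centralizer ({t₀} : Set ((cmDatum L 2 (Matrix.of fun i j : Fin 2 => if i.val + j.val + 1 = 2 then (1 : L) else 0)).Local v × (cmDatum L 1 (Matrix.of fun i j : Fin 1 => if i.val + j.val + 1 = 1 then (1 : L) else 0)).Local v)))), IsRegularElt (((t : ((cmDatum L 2 (Matrix.of fun i j : Fin 2 => if i.val + j.val + 1 = 2 then (1 : L) else 0)).Local v × (cmDatum L 1 (Matrix.of fun i j : Fin 1 => if i.val + j.val + 1 = 1 then (1 : L) else 0)).Local v))).1.val : GL (Fin 2) (LocalRing L v)) → m₀ + 1 ≤ (-WithZero.log (Valued.v ((((P⁻¹).val * ((t : ((cmDatum L 2 (Matrix.of fun i j : Fin 2 => if i.val + j.val + 1 = 2 then (1 : L) else 0)).Local v × (cmDatum L 1 (Matrix.of fun i j : Fin 1 => if i.val + j.val + 1 = 1 then (1 : L) else 0)).Local v)).1.val.val : Matrix (Fin 2) (Fin 2) (LocalRing L v)) * P.val) 0 0 - ((P⁻¹).val * ((t : ((cmDatum L 2 (Matrix.of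 fun i j : Fin 2 => if i.val + j.val + 1 = 2 then (1 : L) else 0)).Local v × (cmDatum L 1 (Matrix.of fun i j : Fin 1 => if i.val + j.val + 1 = 1 then (1 : L) else 0)).Local v)).1.val.val : Matrix (Fin 2) (Fin 2) (LocalRing L v)) * P.val) 1 1) w))).toNat →
      (∫ y, φk k (y * (t : ((cmDatum L 2 (Matrix.of fun i j : Fin 2 => if i.val + j.val + 1 = 2 then (1 : L) else 0)).Local v × (cmDatum L 1 (Matrix.of fun i j : Fin 1 => if i.val + j.val + 1 = 1 then (1 : L) else 0)).Local v)) * y⁻¹) ∂ν) = r k •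
        ((∑ j ∈ (Finset.range ((-WithZero.log (Valued.v ((((P⁻¹).val * ((t : ((cmDatum L 2 (Matrix.of fun i j : Fin 2 => if i.val + j.val + 1 = 2 then (1 : L) else 0)).Local v × (cmDatum L 1 (Matrix.of fun i j : Fin 1 => if i.val + j.val + 1 = 1 then (1 : L) else 0)).Local v)).1.val.val : Matrix (Fin 2) (Fin 2) (LocalRing L v)) * P.val) 0 0 - ((P⁻¹).val * ((t : ((cmDatum L 2 (Matrix.of fun i j : Fin 2 => if i.val + j.val + 1 = 2 then (1 : L) else 0)).Local v × (cmDatum L 1 (Matrix.of fun i j : Fin 1 => if i.val + j.val + 1 = 1 then (1 : L) else 0)).Local v)).1.val.val : Matrix (Fin 2) (Fin 2) (LocalRing L v)) * P.val) 1 1) w))).toNat + 1)).filter (fun j => j % 2 = b k ∧ j + (m₀ + 1) ≤ (-WithZero.log (Valued.v ((((P⁻¹).val * ((t : ((cmDatum L 2 (Matrix.of fun i j : Fin 2 => if i.val + j.val + 1 = 2 then (1 : L) else 0)).Local v × (cmDatum L 1 (Matrix.of fun i j : Fin 1 => if i.val + j.val + 1 = 1 then (1 : L) else 0)).Local v)).1.val.val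 : Matrix (Fin 2) (Fin 2) (LocalRing L v)) * P.val) 0 0 - ((P⁻¹).val * ((t : ((cmDatum L 2 (Matrix.of fun i j : Fin 2 => if i.val + j.val + 1 = 2 then (1 : L) else 0)).Local v × (cmDatum L 1 (Matrix.of fun i j : Fin 1 => if i.val + j.val + 1 = 1 then (1 : L) else 0)).Local v)).1.val.val : Matrix (Fin 2) (Fin 2) (LocalRing L v)) * P.val) 1 1) w))).toNat), (if j = 0 then 1 else (Nat.card (𝓞 ↥(maximalRealSubfield L) ⧸ v.asIdeal)) ^ (j - 1) * ((Nat.card (𝓞 ↥(maximalRealSubfield L) ⧸ v.asIdeal)) + 1))) • φk k (E₂.symm (xm t), ((t : ((cmDatum L 2 (Matrix.of fun i j : Fin 2 => if i.val + j.val + 1 = 2 then (1 : L) else 0)).Local v × (cmDatum L 1 (Matrix.of fun i j : Fin 1 => if i.val + j.val + 1 = 1 then (1 : L) else 0)).Local v))).2) + ∑ i ∈ Finset.range (m₀ + 1), (if i ≤ (-WithZero.log (Valued.v ((((P⁻¹).val * ((t : ((cmDatum L 2 (Matrix.of fun i j : Fin 2 => if i.val + j.val + 1 = 2 then (1 : L)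 else 0)).Local v × (cmDatum L 1 (Matrix.of fun i j : Fin 1 => if i.val + j.val + 1 = 1 then (1 : L) else 0)).Local v)).1.val.val : Matrix (Fin 2) (Fin 2) (LocalRing L v)) * P.val) 0 0 - ((P⁻¹).val * ((t : ((cmDatum L 2 (Matrix.of fun i j : Fin 2 => if i.val + j.val + 1 = 2 then (1 : L) else 0)).Local v × (cmDatum L 1 (Matrix.of fun i j : Fin 1 => if i.val + j.val + 1 = 1 then (1 : L) else 0)).Local v)).1.val.val : Matrix (Fin 2) (Fin 2) (LocalRing L v)) * P.val) 1 1) w))).toNat ∧ ((-WithZero.log (Valued.v ((((P⁻¹).val * ((t : ((cmDatum L 2 (Matrix.of fun i j : Fin 2 => if i.val + j.val + 1 = 2 then (1 : L) else 0)).Local v × (cmDatum L 1 (Matrix.of fun i j : Fin 1 => if i.val + j.val + 1 = 1 then (1 : L) else 0)).Local v)).1.val.val : Matrix (Fin 2) (Fin 2) (LocalRing L v)) * P.val) 0 0 - ((P⁻¹).val * ((t : ((cmDatum L 2 (Matrix.of fun i j : Fin 2 => if i.val + j.val + 1 = 2 then (1 : L) else 0)).Local v × (cmDatum L 1 (Matrix.of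 fun i j : Fin 1 => if i.val + j.val + 1 = 1 then (1 : L) else 0)).Local v)).1.val.val : Matrix (Fin 2) (Fin 2) (LocalRing L v)) * P.val) 1 1) w))).toNat - i) % 2 = b k then (if ((-WithZero.log (Valued.v ((((P⁻¹).val * ((t : ((cmDatum L 2 (Matrix.of fun i j : Fin 2 => if i.val + j.val + 1 = 2 then (1 : L) else 0)).Local v × (cmDatum L 1 (Matrix.of fun i j : Fin 1 => if i.val + j.val + 1 = 1 then (1 : L) else 0)).Local v)).1.val.val : Matrix (Fin 2) (Fin 2) (LocalRing L v)) * P.val) 0 0 - ((P⁻¹).val * ((t : ((cmDatum L 2 (Matrix.of fun i j : Fin 2 => if i.val + j.val + 1 = 2 then (1 : L) else 0)).Local v × (cmDatum L 1 (Matrix.of fun i j : Fin 1 => if i.val + j.val + 1 = 1 then (1 : L) else 0)).Local v)).1.val.val : Matrix (Fin 2) (Fin 2) (LocalRing L v)) * P.val) 1 1) w))).toNat - i) = 0 then 1 else (Nat.card (𝓞 ↥(maximalRealSubfield L) ⧸ v.asIdeal)) ^ (((-WithZero.log (Valued.v ((((P⁻¹).val * ((t : ((cmDatum L 2 (Matrix.of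 fun i j : Fin 2 => if i.val + j.val + 1 = 2 then (1 : L) else 0)).Local v × (cmDatum L 1 (Matrix.of fun i j : Fin 1 => if i.val + j.val + 1 = 1 then (1 : L) else 0)).Local v)).1.val.val : Matrix (Fin 2) (Fin 2) (LocalRing L v)) * P.val) 0 0 - ((P⁻¹).val * ((t : ((cmDatum L 2 (Matrix.of fun i j : Fin 2 => if i.val + j.val + 1 = 2 then (1 : L) else 0)).Local v × (cmDatum L 1 (Matrix.of fun i j : Fin 1 => if i.val + j.val + 1 = 1 then (1 : L) else 0)).Local v)).1.val.val : Matrix (Fin 2) (Fin 2) (LocalRing L v)) * P.val) 1 1) w))).toNat - i) - 1) * ((Nat.card (𝓞 ↥(maximalRealSubfield L) ⧸ v.asIdeal)) + 1)) else 0) • φk k (E₂.symm (XS k i t), ((t : ((cmDatum L 2 (Matrix.of fun i j : Fin 2 => if i.val + j.val + 1 = 2 then (1 : L) else 0)).Local v × (cmDatum L 1 (Matrix.of fun i j : Fin 1 => if i.val + j.val + 1 = 1 then (1 : L) else 0)).Local v))).2)) ∧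
      (∫ y, φk k (y * e (t : ((cmDatum L 2 (Matrix.of fun i j : Fin 2 => if i.val + j.val + 1 = 2 then (1 : L) else 0)).Local v × (cmDatum L 1 (Matrix.of fun i j : Fin 1 => if i.val + j.val + 1 = 1 then (1 : L) else 0)).Local v)) * y⁻¹) ∂ν) = r k •
        ((∑ j ∈ (Finset.range ((-WithZero.log (Valued.v ((((P⁻¹).val * ((t : ((cmDatum L 2 (Matrix.of fun i j : Fin 2 => if i.val + j.val + 1 = 2 then (1 : L) else 0)).Local v × (cmDatum L 1 (Matrix.of fun i j : Fin 1 => if i.val + j.val + 1 = 1 then (1 : L) else 0)).Local v)).1.val.val : Matrix (Fin 2) (Fin 2) (LocalRing L v)) * P.val) 0 0 - ((P⁻¹).val * ((t : ((cmDatum L 2 (Matrix.of fun i j : Fin 2 => if i.val + j.val + 1 = 2 then (1 : L) else 0)).Local v × (cmDatum L 1 (Matrix.of fun i j : Fin 1 => if i.val + j.val + 1 = 1 then (1 : L) else 0)).Local v)).1.val.val : Matrix (Fin 2) (Fin 2) (LocalRing L v)) * P.val) 1 1) w))).toNat + 1)).filter (fun j => j % 2 = (1 - b k) ∧ j + (m₀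 + 1) ≤ (-WithZero.log (Valued.v ((((P⁻¹).val * ((t : ((cmDatum L 2 (Matrix.of fun i j : Fin 2 => if i.val + j.val + 1 = 2 then (1 : L) else 0)).Local v × (cmDatum L 1 (Matrix.of fun i j : Fin 1 => if i.val + j.val + 1 = 1 then (1 : L) else 0)).Local v)).1.val.val : Matrix (Fin 2) (Fin 2) (LocalRing L v)) * P.val) 0 0 - ((P⁻¹).val * ((t : ((cmDatum L 2 (Matrix.of fun i j : Fin 2 => if i.val + j.val + 1 = 2 then (1 : L) else 0)).Local v × (cmDatum L 1 (Matrix.of fun i j : Fin 1 => if i.val + j.val + 1 = 1 then (1 : L) else 0)).Local v)).1.val.val : Matrix (Fin 2) (Fin 2) (LocalRing L v)) * P.val) 1 1) w))).toNat), (if j = 0 then 1 else (Nat.card (𝓞 ↥(maximalRealSubfield L) ⧸ v.asIdeal)) ^ (j - 1) * ((Nat.card (𝓞 ↥(maximalRealSubfield L) ⧸ v.asIdeal)) + 1))) • φk k (E₂.symm (xm t), ((t : ((cmDatum L 2 (Matrix.of fun i j : Fin 2 => if i.val + j.val + 1 = 2 then (1 : L) else 0)).Local v × (cmDatum L 1 (Matrix.of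 fun i j : Fin 1 => if i.val + j.val + 1 = 1 then (1 : L) else 0)).Local v))).2) + ∑ i ∈ Finset.range (m₀ + 1), (if i ≤ (-WithZero.log (Valued.v ((((P⁻¹).val * ((t : ((cmDatum L 2 (Matrix.of fun i j : Fin 2 => if i.val + j.val + 1 = 2 then (1 : L) else 0)).Local v × (cmDatum L 1 (Matrix.of fun i j : Fin 1 => if i.val + j.val + 1 = 1 then (1 : L) else 0)).Local v)).1.val.val : Matrix (Fin 2) (Fin 2) (LocalRing L v)) * P.val) 0 0 - ((P⁻¹).val * ((t : ((cmDatum L 2 (Matrix.of fun i j : Fin 2 => if i.val + j.val + 1 = 2 then (1 : L) else 0)).Local v × (cmDatum L 1 (Matrix.of fun i j : Fin 1 => if i.val + j.val + 1 = 1 then (1 : L) else 0)).Local v)).1.val.val : Matrix (Fin 2) (Fin 2) (LocalRing L v)) * P.val) 1 1) w))).toNat ∧ ((-WithZero.log (Valued.v ((((P⁻¹).val * ((t : ((cmDatum L 2 (Matrix.of fun i j : Fin 2 => if i.val + j.val + 1 = 2 then (1 : L) else 0)).Local v × (cmDatum L 1 (Matrix.of fun i j : Fin 1 => if i.val + j.val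 + 1 = 1 then (1 : L) else 0)).Local v)).1.val.val : Matrix (Fin 2) (Fin 2) (LocalRing L v)) * P.val) 0 0 - ((P⁻¹).val * ((t : ((cmDatum L 2 (Matrix.of fun i j : Fin 2 => if i.val + j.val + 1 = 2 then (1 : L) else 0)).Local v × (cmDatum L 1 (Matrix.of fun i j : Fin 1 => if i.val + j.val + 1 = 1 then (1 : L) else 0)).Local v)).1.val.val : Matrix (Fin 2) (Fin 2) (LocalRing L v)) * P.val) 1 1) w))).toNat - i) % 2 = (1 - b k) then (if ((-WithZero.log (Valued.v ((((P⁻¹).val * ((t : ((cmDatum L 2 (Matrix.of fun i j : Fin 2 => if i.val + j.val + 1 = 2 then (1 : L) else 0)).Local v × (cmDatum L 1 (Matrix.of fun i j : Fin 1 => if i.val + j.val + 1 = 1 then (1 : L) else 0)).Local v)).1.val.val : Matrix (Fin 2) (Fin 2) (LocalRing L v)) * P.val) 0 0 - ((P⁻¹).val * ((t : ((cmDatum L 2 (Matrix.of fun i j : Fin 2 => if i.val + j.val + 1 = 2 then (1 : L) else 0)).Local v × (cmDatum L 1 (Matrix.of fun i j : Fin 1 => if i.val + j.val + 1 = 1 then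 (1 : L) else 0)).Local v)).1.val.val : Matrix (Fin 2) (Fin 2) (LocalRing L v)) * P.val) 1 1) w))).toNat - i) = 0 then 1 else (Nat.card (𝓞 ↥(maximalRealSubfield L) ⧸ v.asIdeal)) ^ (((-WithZero.log (Valued.v ((((P⁻¹).val * ((t : ((cmDatum L 2 (Matrix.of fun i j : Fin 2 => if i.val + j.val + 1 = 2 then (1 : L) else 0)).Local v × (cmDatum L 1 (Matrix.of fun i j : Fin 1 => if i.val + j.val + 1 = 1 then (1 : L) else 0)).Local v)).1.val.val : Matrix (Fin 2) (Fin 2) (LocalRing L v)) * P.val) 0 0 - ((P⁻¹).val * ((t : ((cmDatum L 2 (Matrix.of fun i j : Fin 2 => if i.val + j.val + 1 = 2 then (1 : L) else 0)).Local v × (cmDatum L 1 (Matrix.of fun i j : Fin 1 => if i.val + j.val + 1 = 1 then (1 : L) else 0)).Local v)).1.val.val : Matrix (Fin 2) (Fin 2) (LocalRing L v)) * P.val) 1 1) w))).toNat - i) - 1) * ((Nat.card (𝓞 ↥(maximalRealSubfield L) ⧸ v.asIdeal)) + 1)) else 0) • φk k (E₂.symm (XS k i t), ((t : ((cmDatum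 L 2 (Matrix.of fun i j : Fin 2 => if i.val + j.val + 1 = 2 then (1 : L) else 0)).Local v × (cmDatum L 1 (Matrix.of fun i j : Fin 1 => if i.val + j.val + 1 = 1 then (1 : L) else 0)).Local v))).2)) := by
    intro k t hreg hmN
    rcases hε k with h0 | h1
    · -- self-dual type
      have hKm : ∀ y : ↥(unitaryGroupOfForm (galAdicCompletionMap (L := L) (IsCMField.complexConj L) hw) (placeForm (Matrix.of fun i j : Fin 2 => if i.val + j.val + 1 = 2 then (1 : L) else 0) w.1)), (∀ r s, (toPlace v w (HeckeCharacter.uniformizer ↥(maximalRealSubfield L) v : v.adicCompletion ↥(maximalRealSubfield L))) ^ (-((m₀ + 1 : ℕ) : ℤ)) * ((((y : ↥(unitaryGroupOfForm (galAdicCompletionMap (L := L) (IsCMField.complexConj L) hw) (placeForm (Matrix.of fun i j : Fin 2 => if i.val + j.val + 1 = 2 then (1 : L) else 0) w.1))) : GL (Fin 2) (w.1.adicCompletion L)) : Matrix (Fin 2) (Fin 2) (w.1.adicCompletion L)) - 1) r s ∈ 𝒪[(w.1.adicCompletion L)]) →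
          y ∈ (localCongruenceSubgroup 2 L w.1 m₀).subgroupOf (unitaryGroupOfForm (galAdicCompletionMap (L := L) (IsCMField.complexConj L) hw) (placeForm (Matrix.of fun i j : Fin 2 => if i.val + j.val + 1 = 2 then (1 : L) else 0) w.1)) := fun y hy =>
        hKm₀ y (fun r s => depthPred_anti hϖ _ (Nat.le_succ m₀) hy r s)
      have h := depthExpansion_pair_selfDual L v w hw hunr ν t₀ P d ht₀ hP hd1 σO hσO' hσσ ha₀ E₂ hE₂ hr₀ e he2 heframe (K₂ 0) hdict0 (hK₂o 0) (hK₂c 0)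
        (φk k) (by simpa only [h0] using hφkK k) (by simpa only [h0] using hφkinv k) (m₀ + 1) _ hKm (fun a x' y hy => hφm₀ k a x' y hy)
        xm hxm xs hxs he₀1 he₀par t hreg hmN
      simp only [hr, hb, hXS, if_pos h0]
      rw [h0]
      exact h
    · -- `ϖ`-modular type
      have hk0 : ¬ ε k = 0 := by rw [h1]; exact one_ne_zero
      have hKm : ∀ y : ↥(unitaryGroupOfForm (galAdicCompletionMap (L := L) (IsCMField.complexConj L) hw) (placeForm (Matrix.of fun i j : Fin 2 => if i.val + j.val + 1 = 2 then (1 : L) else 0) w.1)), (∀ r s, (toPlace v w (HeckeCharacter.uniformizer ↥(maximalRealSubfield L) v : v.adicCompletion ↥(maximalRealSubfield L))) ^ (-((m₀ + 1 : ℕ) : ℤ)) *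
          (((((glDiagonal 2 (w.1.adicCompletion L) ![1, Units.mk0 (toPlace v w (HeckeCharacter.uniformizer ↥(maximalRealSubfield L) v : v.adicCompletion ↥(maximalRealSubfield L))) (toPlace_uniformizer_ne_zero L v w hunr)])⁻¹ * ((y : ↥(unitaryGroupOfForm (galAdicCompletionMap (L := L) (IsCMField.complexConj L) hw) (placeForm (Matrix.of fun i j : Fin 2 => if i.val + j.val + 1 = 2 then (1 : L) else 0) w.1))) : GL (Fin 2) (w.1.adicCompletion L)) * (glDiagonal 2 (w.1.adicCompletion L) ![1, Units.mk0 (toPlace v w (HeckeCharacter.uniformizer ↥(maximalRealSubfield L) v : v.adicCompletion ↥(maximalRealSubfield L))) (toPlace_uniformizer_ne_zero L v w hunr)]) : GL (Fin 2) (w.1.adicCompletion L))) : Matrix (Fin 2) (Fin 2) (w.1.adicCompletion L)) - 1) r s ∈ 𝒪[(w.1.adicCompletion L)]) →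
          y ∈ (localCongruenceSubgroup 2 L w.1 m₀).subgroupOf (unitaryGroupOfForm (galAdicCompletionMap (L := L) (IsCMField.complexConj L) hw) (placeForm (Matrix.of fun i j : Fin 2 => if i.val + j.val + 1 = 2 then (1 : L) else 0) w.1)) := fun y hy =>
        hKm₀ y (level_of_conj_glDiagonal_level_succ L v w hunr (y : GL (Fin 2) (w.1.adicCompletion L)) hy)
      have h := depthExpansion_pair_modular L v w hw hunr ν t₀ P d ht₀ hP hd1 σO hσO' hσσ ha₀ E₂ hE₂ hr₀ e he2 heframe (K₂ 1) hdict1 (hK₂o 1) (hK₂c 1)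
        (φk k) (by simpa only [h1] using hφkK k) (by simpa only [h1] using hφkinv k) (m₀ + 1) _ hKm (fun a x' y hy => hφm₀ k a x' y hy)
        xm hxm (fun t i => eϖ.symm (xs t i)) hxs' (by omega : 1 - e₀ ≤ 1) he₁par t hreg hmN
      simp only [hr, hb, hXS, if_neg hk0]
      rw [h1]
      exact h
  -- the pointwise piece sums at `↑t` and at `e ↑t` (★ I-5c twice; trace and properness ★ asm §2)
  have hsumS : ∀ t : ↥(Subgroup.centralizer ({t₀} : Set ((cmDatum L 2 (Matrix.of fun i j : Fin 2 => if i.val + j.val + 1 = 2 then (1 : L) else 0)).Local v × (cmDatum L 1 (Matrix.of fun i j : Fin 1 => if i.val + j.val + 1 = 1 then (1 : L) else 0)).Local v))), IsRegularElt (((t : ((cmDatum L 2 (Matrix.of fun i j : Fin 2 => if i.val + j.val + 1 = 2 then (1 : L) else 0)).Local v × (cmDatum L 1 (Matrix.of fun i j : Fin 1 => if i.val + j.val + 1 = 1 then (1 : L) else 0)).Local v))).1.val : GL (Fin 2) (LocalRing L v)) →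
      (∫ y, f (y * (t : ((cmDatum L 2 (Matrix.of fun i j : Fin 2 => if i.val + j.val + 1 = 2 then (1 : L) else 0)).Local v × (cmDatum L 1 (Matrix.of fun i j : Fin 1 => if i.val + j.val + 1 = 1 then (1 : L) else 0)).Local v)) * y⁻¹) ∂ν) + ∫ y, f (y * e (t : ((cmDatum L 2 (Matrix.of fun i j : Fin 2 => if i.val + j.val + 1 = 2 then (1 : L) else 0)).Local v × (cmDatum L 1 (Matrix.of fun i j : Fin 1 => if i.val + j.val + 1 = 1 then (1 : L) else 0)).Local v)) * y⁻¹) ∂ν = ∑ k, ((∫ y, φk k (y * (t : ((cmDatum L 2 (Matrix.of fun i j : Fin 2 => if i.val + j.val + 1 = 2 then (1 : L) else 0)).Local v × (cmDatum L 1 (Matrix.of fun i j : Fin 1 => if i.val + j.val + 1 = 1 then (1 : L) else 0)).Local v)) * y⁻¹) ∂ν) + ∫ y, φk k (y * e (t : ((cmDatum L 2 (Matrix.of fun i j : Fin 2 => if i.val + j.val + 1 = 2 then (1 : L) else 0)).Local v × (cmDatum L 1 (Matrix.of fun i j : Fin 1 => if i.val + j.val + 1 = 1 then (1 : L) else 0)).Local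 v)) * y⁻¹) ∂ν) := by
    intro t hreg
    have h1 : Valued.v (((((t : ((cmDatum L 2 (Matrix.of fun i j : Fin 2 => if i.val + j.val + 1 = 2 then (1 : L) else 0)).Local v × (cmDatum L 1 (Matrix.of fun i j : Fin 1 => if i.val + j.val + 1 = 1 then (1 : L) else 0)).Local v))).1.val.val : Matrix (Fin 2) (Fin 2) (LocalRing L v)).trace) w) ≤ 1 :=
      valued_trace_le_one_of_mem_centralizer L v w hw t₀ P d ht₀ hP hd1 (t : ((cmDatum L 2 (Matrix.of fun i j : Fin 2 => if i.val + j.val + 1 = 2 then (1 : L) else 0)).Local v × (cmDatum L 1 (Matrix.of fun i j : Fin 1 => if i.val + j.val + 1 = 1 then (1 : L) else 0)).Local v)) t.2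
    have h2 : Valued.v ((((e (t : ((cmDatum L 2 (Matrix.of fun i j : Fin 2 => if i.val + j.val + 1 = 2 then (1 : L) else 0)).Local v × (cmDatum L 1 (Matrix.of fun i j : Fin 1 => if i.val + j.val + 1 = 1 then (1 : L) else 0)).Local v))).1.val.val : Matrix (Fin 2) (Fin 2) (LocalRing L v)).trace) w) ≤ 1 := by
      have h := mem_setOf_valued_trace_le_one_of_isLocalStablyConjH L v w hw t₀ P d ht₀ hP hd1 (t : ((cmDatum L 2 (Matrix.of fun i j : Fin 2 => if i.val + j.val + 1 = 2 then (1 : L) else 0)).Local v × (cmDatum L 1 (Matrix.of fun i j : Fin 1 => if i.val + j.val + 1 = 1 then (1 : L) else 0)).Local v)) t.2 (hest t hreg).1 1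
      simpa only [one_mul, inv_one, mul_one, Set.mem_setOf_eq] using h
    rw [hint (t : ((cmDatum L 2 (Matrix.of fun i j : Fin 2 => if i.val + j.val + 1 = 2 then (1 : L) else 0)).Local v × (cmDatum L 1 (Matrix.of fun i j : Fin 1 => if i.val + j.val + 1 = 1 then (1 : L) else 0)).Local v)) h1 (isCompact_setOf_conj_mem_of_mem_centralizer L v w hw t₀ P d ht₀ hP hd1 (t : ((cmDatum L 2 (Matrix.of fun i j : Fin 2 => if i.val + j.val + 1 = 2 then (1 : L) else 0)).Local v × (cmDatum L 1 (Matrix.of fun i j : Fin 1 => if i.val + j.val + 1 = 1 then (1 : L) else 0)).Local v)) t.2 hreg),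
      hint (e (t : ((cmDatum L 2 (Matrix.of fun i j : Fin 2 => if i.val + j.val + 1 = 2 then (1 : L) else 0)).Local v × (cmDatum L 1 (Matrix.of fun i j : Fin 1 => if i.val + j.val + 1 = 1 then (1 : L) else 0)).Local v))) h2 (isCompact_setOf_conj_map_mem_of_mem_centralizer L v w hw t₀ P d ht₀ hP hd1 e (t : ((cmDatum L 2 (Matrix.of fun i j : Fin 2 => if i.val + j.val + 1 = 2 then (1 : L) else 0)).Local v × (cmDatum L 1 (Matrix.of fun i j : Fin 1 => if i.val + j.val + 1 = 1 then (1 : L) else 0)).Local v)) t.2 hreg), ← Finset.sum_add_distrib]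
  -- THE STABLE FOLD: ★ T6-1u′ (adapter) ∘ pieces ∘ ★ T6-1u (the two sheets add up)
  refine ⟨m₀ + 1, fun t => ∑ k, ((r k : ℝ) : ℂ) * φk k (E₂.symm (xm t), ((t : ((cmDatum L 2 (Matrix.of fun i j : Fin 2 => if i.val + j.val + 1 = 2 then (1 : L) else 0)).Local v × (cmDatum L 1 (Matrix.of fun i j : Fin 1 => if i.val + j.val + 1 = 1 then (1 : L) else 0)).Local v))).2),
    fun i t => ∑ k, ((r k : ℝ) : ℂ) * φk k (E₂.symm (XS k i t), ((t : ((cmDatum L 2 (Matrix.of fun i j : Fin 2 => if i.val + j.val + 1 = 2 then (1 : L) else 0)).Local v × (cmDatum L 1 (Matrix.of fun i j : Fin 1 => if i.val + j.val + 1 = 1 then (1 : L) else 0)).Local v))).2), ?_, ?_, ?_⟩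
  · -- `Φm` is locally constant (★ S3 with `M = 1`)
    refine isLocallyConstant_finset_sum Finset.univ (fun k t => ((r k : ℝ) : ℂ) * φk k (E₂.symm (xm t), ((t : ((cmDatum L 2 (Matrix.of fun i j : Fin 2 => if i.val + j.val + 1 = 2 then (1 : L) else 0)).Local v × (cmDatum L 1 (Matrix.of fun i j : Fin 1 => if i.val + j.val + 1 = 1 then (1 : L) else 0)).Local v))).2)) fun k _ => ?_
    exact isLocallyConstant_const_mul (((r k : ℝ) : ℂ))
      (isLocallyConstant_apply_symm_frameScalar_snd L v w hw hunr t₀ P d ht₀ hP hd1 E₂ (φk k) (hφk k).1 m₀ (hS3 k) 1 (1 : Matrix (Fin 2) (Fin 2) (w.1.adicCompletion L)) xm hxm)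
  · -- each `Φ i` is locally constant (★ S3 with `M = 1 + ϖ_w^i N_δ`, resp. `1 + ϖ_w^i ϖ_w⁻¹ N_δ`)
    intro i _
    refine isLocallyConstant_finset_sum Finset.univ (fun k t => ((r k : ℝ) : ℂ) * φk k (E₂.symm (XS k i t), ((t : ((cmDatum L 2 (Matrix.of fun i j : Fin 2 => if i.val + j.val + 1 = 2 then (1 : L) else 0)).Local v × (cmDatum L 1 (Matrix.of fun i j : Fin 1 => if i.val + j.val + 1 = 1 then (1 : L) else 0)).Local v))).2)) fun k _ => ?_
    refine isLocallyConstant_const_mul (((r k : ℝ) : ℂ)) ?_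
    rcases hε k with h0 | h1
    · have hfun : (fun t : ↥(Subgroup.centralizer ({t₀} : Set ((cmDatum L 2 (Matrix.of fun i j : Fin 2 => if i.val + j.val + 1 = 2 then (1 : L) else 0)).Local v × (cmDatum L 1 (Matrix.of fun i j : Fin 1 => if i.val + j.val + 1 = 1 then (1 : L) else 0)).Local v))) => φk k (E₂.symm (XS k i t), ((t : ((cmDatum L 2 (Matrix.of fun i j : Fin 2 => if i.val + j.val + 1 = 2 then (1 : L) else 0)).Local v × (cmDatum L 1 (Matrix.of fun i j : Fin 1 => if i.val + j.val + 1 = 1 then (1 : L) else 0)).Local v))).2)) = fun t : ↥(Subgroup.centralizer ({t₀} : Set ((cmDatum L 2 (Matrix.of fun i j : Fin 2 => if i.val + j.val + 1 = 2 then (1 : L) else 0)).Local v × (cmDatum L 1 (Matrix.of fun i j : Fin 1 => if i.val + j.val + 1 = 1 then (1 : L) else 0)).Local v))) => φk k (E₂.symm (xs t i), ((t : ((cmDatum L 2 (Matrix.of fun i j : Fin 2 => if i.val + j.val + 1 = 2 then (1 : L) else 0)).Local v × (cmDatum L 1 (Matrix.of fun i j : Fin 1 => if i.val + j.val + 1 =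 1 then (1 : L) else 0)).Local v))).2) := by
        funext t; rw [hXS, if_pos h0]
      rw [hfun]
      exact isLocallyConstant_apply_symm_frameScalar_snd L v w hw hunr t₀ P d ht₀ hP hd1 E₂ (φk k) (hφk k).1 m₀ (hS3 k) 1 _ (fun t => xs t i) (fun t => hxs t i)
    · have hk0 : ¬ ε k = 0 := by rw [h1]; exact one_ne_zero
      have hfun : (fun t : ↥(Subgroup.centralizer ({t₀} : Set ((cmDatum L 2 (Matrix.of fun i j : Fin 2 => if i.val + j.val + 1 = 2 then (1 : L) else 0)).Local v × (cmDatum L 1 (Matrix.of fun i j : Fin 1 => if i.val + j.val + 1 = 1 then (1 : L) else 0)).Local v))) => φk k (E₂.symm (XS k i t), ((t : ((cmDatum L 2 (Matrix.of fun i j : Fin 2 => if i.val + j.val + 1 = 2 then (1 : L) else 0)).Local v × (cmDatum L 1 (Matrix.of fun i j : Fin 1 => if i.val + j.val + 1 = 1 then (1 : L) else 0)).Local v))).2)) = fun t : ↥(Subgroup.centralizer ({t₀} : Set ((cmDatum L 2 (Matrix.of fun i j : Fin 2 => if i.val + j.val + 1 = 2 then (1 : L) else 0)).Local v × (cmDatum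 L 1 (Matrix.of fun i j : Fin 1 => if i.val + j.val + 1 = 1 then (1 : L) else 0)).Local v))) => φk k (E₂.symm (eϖ.symm (xs t i)), ((t : ((cmDatum L 2 (Matrix.of fun i j : Fin 2 => if i.val + j.val + 1 = 2 then (1 : L) else 0)).Local v × (cmDatum L 1 (Matrix.of fun i j : Fin 1 => if i.val + j.val + 1 = 1 then (1 : L) else 0)).Local v))).2) := by
        funext t; rw [hXS, if_neg hk0]
      rw [hfun]
      exact isLocallyConstant_apply_symm_frameScalar_snd L v w hw hunr t₀ P d ht₀ hP hd1 E₂ (φk k) (hφk k).1 m₀ (hS3 k) 1 _ (fun t => eϖ.symm (xs t i)) (fun t => hxs' t i)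
  · -- the identity: adapter, pieces, the two sheets
    intro t hRt hmN
    have hreg : IsRegularElt (((t : ((cmDatum L 2 (Matrix.of fun i j : Fin 2 => if i.val + j.val + 1 = 2 then (1 : L) else 0)).Local v × (cmDatum L 1 (Matrix.of fun i j : Fin 1 => if i.val + j.val + 1 = 1 then (1 : L) else 0)).Local v))).1.val : GL (Fin 2) (LocalRing L v)) := hReg _ hRt
    rw [stableOrbitalIntegralRel_eq_integral_add_integral_of_frame L v hv ν m Reg hReg hconj hstab hm f hf t₀ P d ht₀ hP hd1 t hRt (e (t : ((cmDatum L 2 (Matrix.of fun i j : Fin 2 => if i.val + j.val + 1 = 2 then (1 : L) else 0)).Local v × (cmDatum L 1 (Matrix.of fun i j : Fin 1 => if i.val + j.val + 1 = 1 then (1 : L) else 0)).Local v))) (hest t hreg).1 (hest t hreg).2,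
      hsumS t hreg]
    exact sum_add_eq_depthExpansion_of_paritySums (Nat.card (𝓞 ↥(maximalRealSubfield L) ⧸ v.asIdeal)) hmN b hb1 r (fun k => φk k (E₂.symm (xm t), ((t : ((cmDatum L 2 (Matrix.of fun i j : Fin 2 => if i.val + j.val + 1 = 2 then (1 : L) else 0)).Local v × (cmDatum L 1 (Matrix.of fun i j : Fin 1 => if i.val + j.val + 1 = 1 then (1 : L) else 0)).Local v))).2))
      (fun k i => φk k (E₂.symm (XS k i t), ((t : ((cmDatum L 2 (Matrix.of fun i j : Fin 2 => if i.val + j.val + 1 = 2 then (1 : L) else 0)).Local v × (cmDatum L 1 (Matrix.of fun i j : Fin 1 => if i.val + j.val + 1 = 1 then (1 : L) else 0)).Local v))).2)) (fun k => ∫ y, φk k (y * (t : ((cmDatum L 2 (Matrix.of fun i j : Fin 2 => if i.val + j.val + 1 = 2 then (1 : L) else 0)).Local v × (cmDatum L 1 (Matrix.of fun i j : Fin 1 => if i.val + j.val + 1 = 1 then (1 : L) else 0)).Local v)) * y⁻¹) ∂ν) (fun k => ∫ y, φk k (y * e (t : ((cmDatum L 2 (Matrix.of fun i j : Fin 2 =>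 if i.val + j.val + 1 = 2 then (1 : L) else 0)).Local v × (cmDatum L 1 (Matrix.of fun i j : Fin 1 => if i.val + j.val + 1 = 1 then (1 : L) else 0)).Local v)) * y⁻¹) ∂ν)
      (fun k => (hpair k t hreg hmN).1) (fun k => (hpair k t hreg hmN).2)

end StableHead

end Literature.NumberTheory.Rogawski1990

end
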